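import Mathlib
import HarnessLib
import Summits.ResolutionOfSingularities.ResolutionOfSingularities.Theorems.WildQuotientsWildQuotientResolutionTerminalBlowupChartPackage
import Summits.ResolutionOfSingularities.ResolutionOfSingularities.Theorems.WildQuotientsWildQuotientResolutionTerminalBlowupSpec
import Summits.ResolutionOfSingularities.ResolutionOfSingularities.Theorems.WildQuotientsWildQuotientResolutionJordanThreeChartAlgebra
import Summits.ResolutionOfSingularities.ResolutionOfSingularities.Theorems.WildQuotientsWildQuotientResolutionJordanThreeK3ChartAlgebra
import Summits.ResolutionOfSingularities.ResolutionOfSingularities.Theorems.WildQuotientsWildQuotientResolutionJordanThreeCentre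
import Summits.ResolutionOfSingularities.ResolutionOfSingularities.Theorems.WildQuotientsWildQuotientResolutionJordanThreeOrderP
import Summits.ResolutionOfSingularities.ResolutionOfSingularities.Theorems.WildQuotientsWildQuotientResolutionLinearSmallBlocksAlgebra

/-!
# Toric exit (V3U): the divisorial clause over the `x_b²`-chart of `Bl_{(x_a, x_b²)} 𝔸ⁿ`, every `p ≥ 3`
(crux stmt-ResolutionOfSingularities-15640 `WildQuotients.WildQuotientResolution`, line `Sketch`;
chain w45c programme V3U of `L/w45c/CHAIN.md` v5 §4 (lead-1 row, «instance data for E1: Y_b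
regular»), CRUX-PLAN v5 §U (B); [OURS · L1 W4.5c] — NOT a statement of any manuscript.)

For the `J₃` datum `σ x_a = x_a`, `σ x_b = x_b + x_a`, `σ x_c = x_c + x_b` over a field of
characteristic `p ≥ 3` the centre `I₂ = (x_a, x_b²)` (the `(2,1)`-weighted blow-up of `Fix σ`) is
`⟨σ⟩`-stable; `V = Bl_{I₂} 𝔸ⁿ` is NOT regular and the lifted action is NOT terminal on the
`x_a`-chart (the `A₁`-fibred cone, CRUX-PLAN v5 §U (C)) — but over the `x_b²`-chart it is:

* `ToricExit.span_smul_sub_eq_centre_prime` — for every `1 ≠ g ∈ ⟨σ⟩`, `char k = p ≥ 3`: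
  `⟨g • f - f⟩ = (x_a, x_b)` (stub-1's `JordanThree.span_smul_sub_eq_centre` for all `p ≥ 3`).
* `ToricExit.I2.chart_isPrincipal` — chart algebra: in the abstract chart package with
  `T = x_a` or `T = x_b²` a non-zero-divisor, `T · U l ∈ {x_a, x_b²}`, `a x_a = x_a`,
  `a x_b = x_b + m x_a`, AND `x_a ∈ (x_b²)` (i.e. over the `x_b²`-chart), the ideal
  `(x_a, x_b) + (a (U l) - U l)` equals `(x_b)` — any characteristic.
* `ToricExit.I2.isPrincipal_stalkAug_liftAction_of_mem` — for ANY blow-up `π : V → 𝔸ⁿ` along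
  `Ĩ₂` with `Ĩ₂` `ρ`-stable, every `g ∈ ⟨σ⟩` and every point `v` fixed by the lift with
  `x_a ∈ (x_b²)·𝒪_{V,v}` (every point of the stable affine `W_b = ⋂ σˡ D₊(x_b²t)`), the stalk
  augmentation ideal is principal (mechanism of `JordanThree.K3.isPrincipal_stalkAug_liftAction`,
  p485276); the K–L input making the quotient piece `Y_b = W_b/σ` regular (CRUX-PLAN v5 §U (B)(E)).
-/

-- single-problem summit: the doubled namespace component `ResolutionOfSingularities` is forced
set_option linter.dupNamespace false

noncomputable section

open CategoryTheory AlgebraicGeometry TopologicalSpace IsLocalRing MvPolynomial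
open Literature.AlgebraicGeometry.Resolution
open scoped Pointwise

namespace Summit.ResolutionOfSingularities.ResolutionOfSingularities.Theorems.WildQuotientResolution.ToricExit

/-- **The centre IS the augmentation ideal, every `p ≥ 3`**: for `1 ≠ g ∈ ⟨σ⟩`,
`⟨g • f - f : f ∈ k[x]⟩ = (x_a, x_b)` (stub-1's `JordanThree.span_smul_sub_eq_centre`, whose proof is
followed verbatim with `3` replaced by `p`; `σ ^ p = 1` is `JordanThree.pow_prime_eq_one`).
[folklore] -/
theorem span_smul_sub_eq_centre_prime (p : ℕ) (hp : p.Prime) (hp3 : 3 ≤ p) (k : Type) [Field k]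
    [CharP k p] (n : ℕ) (σ : MvPolynomial (Fin n) k ≃ₐ[k] MvPolynomial (Fin n) k) (a b c : Fin n)
    (hab : a ≠ b) (hac : a ≠ c) (hb : σ (X b) = X b + X a) (hc : σ (X c) = X c + X b)
    (hσ : ∀ i, i ≠ b → i ≠ c → σ (X i) = X i) (g : Subgroup.zpowers σ) (hg : g ≠ 1) :
    Ideal.span (Set.range fun f : MvPolynomial (Fin n) k => g • f - f) =
      Ideal.span ({X a, X b} : Set (MvPolynomial (Fin n) k)) := by
  classical
  have hσp : σ ^ p = 1 := JordanThree.pow_prime_eq_one p hp hp3 k n σ a b c hab hac hb hc hσ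
  have ha : σ (X a) = X a := hσ a hab hac
  apply le_antisymm
  · rw [Ideal.span_le]
    rintro _ ⟨f, rfl⟩
    exact JordanThree.smul_sub_mem_centre k n σ a b c hb hc hσ g f
  have hXa : (X a : MvPolynomial (Fin n) k) ∈
      Ideal.span (Set.range fun f : MvPolynomial (Fin n) k => g • f - f) :=
    LinearSmallBlocks.X_mem_augIdeal_of_transvection k p hp σ a b ha hb hσp g hg
  -- `g = σ ^ m` with `p ∤ m`
  have hfin : IsOfFinOrder σ := isOfFinOrder_iff_pow_eq_one.mpr ⟨p, hp.pos, hσp⟩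
  obtain ⟨m, hm⟩ : (g : MvPolynomial (Fin n) k ≃ₐ[k] MvPolynomial (Fin n) k) ∈ Submonoid.powers σ :=
    hfin.mem_powers_iff_mem_zpowers.mpr g.2
  have hm' : σ ^ m = (g : MvPolynomial (Fin n) k ≃ₐ[k] MvPolynomial (Fin n) k) := hm
  have hndvd : ¬ p ∣ m := by
    rintro ⟨l, rfl⟩
    apply hg
    apply Subtype.ext
    change (g : MvPolynomial (Fin n) k ≃ₐ[k] MvPolynomial (Fin n) k) = 1
    rw [← hm', pow_mul, hσp, one_pow]
  have hmk : (m : k) ≠ 0 := fun h => hndvd ((CharP.cast_eq_zero_iff k p m).mp h)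
  have hXb : (X b : MvPolynomial (Fin n) k) ∈
      Ideal.span (Set.range fun f : MvPolynomial (Fin n) k => g • f - f) := by
    have hsmul : g • (X c : MvPolynomial (Fin n) k) - X c =
        (m : MvPolynomial (Fin n) k) * X b + ((m.choose 2 : ℕ) : MvPolynomial (Fin n) k) * X a := by
      change (g : MvPolynomial (Fin n) k ≃ₐ[k] MvPolynomial (Fin n) k) (X c) - X c = _
      rw [← hm', JordanThree.pow_apply_X_c k n σ a b c hab hac hb hc hσ m]
      ring
    have hmXb : (m : MvPolynomial (Fin n) k) * X b ∈
        Ideal.span (Set.range fun f : MvPolynomial (Fin n) k => g • f - f) := by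
      have e : (m : MvPolynomial (Fin n) k) * X b =
          (g • (X c : MvPolynomial (Fin n) k) - X c) -
            ((m.choose 2 : ℕ) : MvPolynomial (Fin n) k) * X a := by
        rw [hsmul]; ring
      rw [e]
      exact Ideal.sub_mem _ (Ideal.subset_span ⟨X c, rfl⟩) (Ideal.mul_mem_left _ _ hXa)
    have hx : (X b : MvPolynomial (Fin n) k) =
        C ((m : k)⁻¹) * ((m : MvPolynomial (Fin n) k) * X b) := by
      rw [← mul_assoc, ← map_natCast (C : k →+* MvPolynomial (Fin n) k) m, ← map_mul,
        inv_mul_cancel₀ hmk, map_one, one_mul]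
    rw [hx]
    exact Ideal.mul_mem_left _ _ hmXb
  rw [Ideal.span_le]
  intro x hx
  simp only [Set.mem_insert_iff, Set.mem_singleton_iff] at hx
  rcases hx with rfl | rfl
  · exact hXa
  · exact hXb

/-- Every `1 ≠ g ∈ ⟨σ⟩` is `σᵐ` with `m` a unit in `k` (characteristic `p ≥ 3`, `σ ^ p = 1`).
[folklore] -/
theorem exists_pow_eq_of_ne_one_prime (p : ℕ) (hp : p.Prime) (hp3 : 3 ≤ p) (k : Type) [Field k]
    [CharP k p] (n : ℕ) (σ : MvPolynomial (Fin n) k ≃ₐ[k] MvPolynomial (Fin n) k) (a b c : Fin n)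
    (hab : a ≠ b) (hac : a ≠ c) (hb : σ (X b) = X b + X a) (hc : σ (X c) = X c + X b)
    (hσ : ∀ i, i ≠ b → i ≠ c → σ (X i) = X i)
    (g : Subgroup.zpowers σ) (hg : g ≠ 1) :
    ∃ m : ℕ, σ ^ m = (g : MvPolynomial (Fin n) k ≃ₐ[k] MvPolynomial (Fin n) k) ∧ (m : k) ≠ 0 := by
  have hσp : σ ^ p = 1 := JordanThree.pow_prime_eq_one p hp hp3 k n σ a b c hab hac hb hc hσ
  have hfin : IsOfFinOrder σ := isOfFinOrder_iff_pow_eq_one.mpr ⟨p, hp.pos, hσp⟩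
  obtain ⟨m, hm⟩ : (g : MvPolynomial (Fin n) k ≃ₐ[k] MvPolynomial (Fin n) k) ∈ Submonoid.powers σ :=
    hfin.mem_powers_iff_mem_zpowers.mpr g.2
  have hm' : σ ^ m = (g : MvPolynomial (Fin n) k ≃ₐ[k] MvPolynomial (Fin n) k) := hm
  refine ⟨m, hm', fun h => ?_⟩
  have hdvd : p ∣ m := (CharP.cast_eq_zero_iff k p m).mp h
  obtain ⟨l, rfl⟩ := hdvd
  apply hg
  apply Subtype.ext
  change (g : MvPolynomial (Fin n) k ≃ₐ[k] MvPolynomial (Fin n) k) = 1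
  rw [← hm', pow_mul, hσp, one_pow]

/-- **Chart algebra of `Bl_{(x_a, x_b²)}` over the `x_b²`-chart** (both Rees charts `j : Fin 2`;
any commutative ring `S`, any characteristic): with `T = x_a` resp. `x_b²` a non-zero-divisor,
`T · U 0 = x_a`, `T · U 1 = x_b²`, `a x_a = x_a`, `a x_b = x_b + m x_a`, and `x_a ∈ (x_b²)`, the
ideal `(x_a, x_b) + (a (U l) - U l : l ≠ j)` is `(x_b)`; in particular principal. (`j = 1`:
`x_a = v x_b²`, `a v (1 + m x_b v)² = v`; `j = 0`: `a r = r + 2m x_b + m² x_a`.) [folklore] -/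
theorem I2.chart_isPrincipal {S : Type} [CommRing S] (Xa Xb T m : S) (U : Fin 2 → S) (a : S →+* S)
    (haXa : a Xa = Xa) (haXb : a Xb = Xb + m * Xa) (hT : T ∈ nonZeroDivisors S) (j : Fin 2)
    (hTj : T = ![Xa, Xb ^ 2] j) (hU0 : T * U 0 = Xa) (hU1 : T * U 1 = Xb ^ 2)
    (hmem : Xa ∈ Ideal.span ({Xb ^ 2} : Set S)) :
    (Ideal.span {Xa, Xb} ⊔
      Ideal.span (Set.range fun l : {l : Fin 2 // l ≠ j} => a (U l) - U l)).IsPrincipal := by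
  obtain ⟨w, hw⟩ := Ideal.mem_span_singleton'.mp hmem
  have hXaXb : Xa ∈ Ideal.span ({Xb} : Set S) := Ideal.mem_span_singleton'.mpr ⟨w * Xb, by
    rw [← hw]; ring⟩
  suffices h : Ideal.span {Xa, Xb} ⊔
      Ideal.span (Set.range fun l : {l : Fin 2 // l ≠ j} => a (U l) - U l) = Ideal.span {Xb} by
    rw [h]; exact ⟨⟨Xb, rfl⟩⟩
  apply le_antisymm
  swap
  · exact (Ideal.span_singleton_le_iff_mem _).mpr
      (Ideal.mem_sup_left (Ideal.subset_span (Set.mem_insert_of_mem _ (Set.mem_singleton _))))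
  refine sup_le ?_ ?_
  · rw [Ideal.span_le]
    intro x hx
    simp only [Set.mem_insert_iff, Set.mem_singleton_iff] at hx
    rcases hx with rfl | rfl
    · exact hXaXb
    · exact Ideal.mem_span_singleton_self _
  rw [Ideal.span_le]
  rintro _ ⟨⟨l, hl⟩, rfl⟩
  change a (U l) - U l ∈ Ideal.span {Xb}
  fin_cases j
  · -- chart `x_a`: `T = Xa`, `U 1 = r` with `Xa r = Xb²`, `a r = r + 2 m Xb + m² Xa`
    have hT0 : T = Xa := by simpa using hTj
    rw [hT0] at hT hU1
    fin_cases l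
    · exact absurd rfl hl
    · show a (U 1) - U 1 ∈ Ideal.span {Xb}
      have har : a (U 1) = U 1 + (2 * m * Xb + m ^ 2 * Xa) := by
        refine JordanThree.K3.cancel_nzd hT ?_
        have h := congrArg a hU1
        rw [map_mul, haXa, map_pow, haXb] at h
        rw [h, mul_add, hU1]
        ring
      rw [har, add_sub_cancel_left]
      exact Ideal.add_mem _ (Ideal.mul_mem_left _ _ (Ideal.mem_span_singleton_self _))
        (Ideal.mul_mem_left _ _ hXaXb)
  · -- chart `x_b²`: `T = Xb²`, `U 0 = v` with `Xb² v = Xa`, `a v (1 + m Xb v)² = v`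
    have hT1 : T = Xb ^ 2 := by simpa using hTj
    rw [hT1] at hT hU0 hU1
    fin_cases l
    · show a (U 0) - U 0 ∈ Ideal.span {Xb}
      have hXa : Xa = U 0 * Xb ^ 2 := by rw [← hU0]; ring
      have haXb' : a Xb = Xb * (1 + m * Xb * U 0) := by rw [haXb, hXa]; ring
      have hav : a (U 0) * (1 + m * Xb * U 0) ^ 2 = U 0 := by
        refine JordanThree.K3.cancel_nzd hT ?_
        have h := congrArg a hU0
        rw [map_mul, map_pow, haXb', haXa] at h
        linear_combination h - hU0 + 0 * hXa
      refine Ideal.mem_span_singleton'.mpr ⟨-(a (U 0) * m * U 0 * (2 + m * Xb * U 0)), ?_⟩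
      linear_combination (-1 : S) * hav
    · exact absurd rfl hl

-- the stalk / Rees-chart unifications of this assembly are individually cheap but numerous
set_option maxHeartbeats 1600000 in
/-- **The divisorial clause over the `x_b²`-chart of `Bl_{(x_a, x_b²)} 𝔸ⁿ`, every `p ≥ 3`.**
Let `σ x_a = x_a`, `σ x_b = x_b + x_a`, `σ x_c = x_c + x_b`, `σ xᵢ = xᵢ` otherwise, over a field
`k` with `char k = p ≥ 3`; `K : Fin 2 → k[x]` the generators `x_a, x_b²` of `I₂`; `ρ g = Spec (g⁻¹)`;
`π : V → 𝔸ⁿ` any blow-up along `Ĩ₂` with `Ĩ₂` `ρ`-stable (`hJ`). Then for every `g ∈ ⟨σ⟩` and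
every point `v` fixed by the lift `(liftAction ρ) g` AT WHICH `x_a ∈ (x_b²)·𝒪_{V,v}` (the points
over the `x_b²`-chart), the augmentation ideal `⟨(stalkSpecializes ≫ (liftAction ρ g)^♯_v) y - y⟩`
is principal. [OURS · L1 W4.5c] [folklore; assembly of landed decls] -/
theorem I2.isPrincipal_stalkAug_liftAction_of_mem (p : ℕ) (hp : p.Prime) (hp3 : 3 ≤ p)
    (k : Type) [Field k] [CharP k p] (n : ℕ)
    (σ : MvPolynomial (Fin n) k ≃ₐ[k] MvPolynomial (Fin n) k) (a b c : Fin n)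
    (hab : a ≠ b) (hac : a ≠ c) (hb : σ (X b) = X b + X a) (hc : σ (X c) = X c + X b)
    (hσ : ∀ i, i ≠ b → i ≠ c → σ (X i) = X i)
    (K : Fin 2 → MvPolynomial (Fin n) k) (hK0 : K 0 = X a) (hK1 : K 1 = X b ^ 2)
    (ρ : ↥(Subgroup.zpowers σ) →* Aut (Spec (CommRingCat.of (MvPolynomial (Fin n) k))))
    (hρ : ∀ g : ↥(Subgroup.zpowers σ), (ρ g).hom = Spec.map (CommRingCat.ofHom
      ((MulSemiringAction.toRingEquiv (↥(Subgroup.zpowers σ)) (MvPolynomial (Fin n) k) g⁻¹ :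
        MvPolynomial (Fin n) k ≃+* MvPolynomial (Fin n) k) :
          MvPolynomial (Fin n) k →+* MvPolynomial (Fin n) k)))
    {V : Scheme.{0}} {π : V ⟶ Spec (CommRingCat.of (MvPolynomial (Fin n) k))}
    (hπ : IsBlowup π (affineBlowup.idealSheaf (Ideal.span (Set.range K))))
    (hJ : ∀ g : ↥(Subgroup.zpowers σ),
      (affineBlowup.idealSheaf (Ideal.span (Set.range K))).comap (ρ g).hom =
        affineBlowup.idealSheaf (Ideal.span (Set.range K)))
    (g : ↥(Subgroup.zpowers σ)) (v : V) (hv : ((hπ.liftAction ρ hJ) g).hom.base v = v)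
    (hmem : (π.stalkMap v).hom (((Scheme.ΓSpecIso (CommRingCat.of (MvPolynomial (Fin n) k))).inv ≫
        (Spec (CommRingCat.of (MvPolynomial (Fin n) k))).presheaf.germ ⊤ (π.base v) trivial).hom
          (X a)) ∈ Ideal.span {(π.stalkMap v).hom
        (((Scheme.ΓSpecIso (CommRingCat.of (MvPolynomial (Fin n) k))).inv ≫
          (Spec (CommRingCat.of (MvPolynomial (Fin n) k))).presheaf.germ ⊤ (π.base v) trivial).hom
            (X b)) ^ 2}) :
    (Ideal.span (Set.range fun y =>
      (V.presheaf.stalkSpecializes (specializes_of_eq hv) ≫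
        ((hπ.liftAction ρ hJ) g).hom.stalkMap v).hom y - y)).IsPrincipal := by
  classical
  -- the germ map `(MvPolynomial (Fin n) k) → 𝒪_{𝔸ⁿ, π v}` and the action of `g⁻¹` on `(MvPolynomial (Fin n) k)`
  obtain ⟨γ, hγdef⟩ : ∃ γ : (MvPolynomial (Fin n) k) →+*
      (Spec (CommRingCat.of (MvPolynomial (Fin n) k))).presheaf.stalk (π.base v),
      γ = ((Scheme.ΓSpecIso (CommRingCat.of (MvPolynomial (Fin n) k))).inv ≫
        (Spec (CommRingCat.of (MvPolynomial (Fin n) k))).presheaf.germ ⊤ (π.base v) trivial).hom :=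
    ⟨_, rfl⟩
  rw [← hγdef] at hmem
  set φ : (MvPolynomial (Fin n) k) →+* (MvPolynomial (Fin n) k) := ((MulSemiringAction.toRingEquiv _ (MvPolynomial (Fin n) k) g⁻¹ : (MvPolynomial (Fin n) k) ≃+* (MvPolynomial (Fin n) k)) : (MvPolynomial (Fin n) k) →+* (MvPolynomial (Fin n) k)) with hφ
  have hφapp : ∀ F : (MvPolynomial (Fin n) k), φ F = g⁻¹ • F := fun F => rfl
  by_cases hg : g = 1
  · -- `g = 1`: the lift is the identity and the ideal is `⊥`
    have hρg : (ρ g).hom = 𝟙 _ := by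
      rw [hρ]
      have : ((MulSemiringAction.toRingEquiv _ (MvPolynomial (Fin n) k) g⁻¹ : (MvPolynomial (Fin n) k) ≃+* (MvPolynomial (Fin n) k)) : (MvPolynomial (Fin n) k) →+* (MvPolynomial (Fin n) k)) = RingHom.id _ := by
        refine RingHom.ext fun F => ?_
        change (MulSemiringAction.toRingEquiv _ _ g⁻¹) F = F
        rw [MulSemiringAction.toRingEquiv_apply_apply, hg, inv_one, one_smul]
      rw [this, CommRingCat.ofHom_id, Spec.map_id]
    have hlift : (hπ.liftAction ρ hJ g).hom = 𝟙 _ :=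
      hπ.eq_id_of_comp_eq (by rw [hπ.liftAction_hom_comp, hρg, Category.comp_id])
    have key : ∀ (f : V ⟶ V) (_ : f = 𝟙 V) (hvf : f.base v = v),
        Ideal.span (Set.range fun s : V.presheaf.stalk v =>
          (V.presheaf.stalkSpecializes (specializes_of_eq hvf) ≫ f.stalkMap v).hom s - s) = ⊥ := by
      intro f hf hvf
      subst hf
      refine Ideal.span_eq_bot.mpr ?_
      rintro _ ⟨s, rfl⟩
      change ((𝟙 V : V ⟶ V).stalkMap v).hom
        ((V.presheaf.stalkSpecializes (specializes_of_eq hvf)).hom s) - s = 0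
      erw [Scheme.Hom.stalkMap_id]
      rw [sub_eq_zero]
      exact stalkSpecializes_self_apply V.presheaf v _ s
    rw [key _ hlift hv]
    exact bot_isPrincipal
  -- `g ≠ 1`: `g⁻¹ = σᵐ` with `m` a unit in `k`
  have hg' : g⁻¹ ≠ 1 := fun h => hg (inv_eq_one.mp h)
  obtain ⟨m, hm, hmk⟩ := exists_pow_eq_of_ne_one_prime p hp hp3 k n σ a b c hab hac hb hc hσ g⁻¹ hg'
  have hgXa : g⁻¹ • (X a : (MvPolynomial (Fin n) k)) = X a := by
    change ((g⁻¹ : Subgroup.zpowers σ) : (MvPolynomial (Fin n) k) ≃ₐ[k] (MvPolynomial (Fin n) k)) (X a) = X a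
    rw [← hm]
    exact JordanThree.pow_apply_X_of_ne k n σ b c hσ m a hab hac
  have hgXb : g⁻¹ • (X b : (MvPolynomial (Fin n) k)) = X b + (m : (MvPolynomial (Fin n) k)) * X a := by
    change ((g⁻¹ : Subgroup.zpowers σ) : (MvPolynomial (Fin n) k) ≃ₐ[k] (MvPolynomial (Fin n) k)) (X b) = _
    rw [← hm]
    exact JordanThree.pow_apply_X_b k n σ a b c hab hac hb hσ m
  have hcK : Ideal.span (Set.range fun l => γ (K l)) =
      stalkIdeal (affineBlowup.idealSheaf (Ideal.span (Set.range K))) (π.base v) := by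
    rw [stalkIdeal_eq_map_germ (affineBlowup.idealSheaf (Ideal.span (Set.range K)))
      ⟨⊤, isAffineOpen_top (Spec (CommRingCat.of (MvPolynomial (Fin n) k)))⟩ trivial]
    change _ = Ideal.map _ ((Scheme.IdealSheafData.ofIdealTop _).ideal
      ⟨⊤, isAffineOpen_top (Spec (CommRingCat.of (MvPolynomial (Fin n) k)))⟩)
    rw [ideal_ofIdealTop_top, Ideal.map_map, Ideal.map_span, ← Set.range_comp, hγdef]
    rfl
  refine TerminalBlowup.stalkAug_of_chartPackage hπ (hπ.liftAction_hom_comp ρ hJ g) v hv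
    (fun l => γ (K l)) hcK (fun I => I.IsPrincipal) ?_
  intro hs j 𝔴 χ hχ hloc hmax hab'
  set aH := V.presheaf.stalkSpecializes (specializes_of_eq hv) ≫
    ((hπ.liftAction ρ hJ) g).hom.stalkMap v with haH
  set bH := (Spec (CommRingCat.of (MvPolynomial (Fin n) k))).presheaf.stalkSpecializes (specializes_of_eq hs) ≫
    (ρ g).hom.stalkMap (π.base v) with hbH
  have key : ∀ (f : Spec (CommRingCat.of (MvPolynomial (Fin n) k)) ⟶ Spec (CommRingCat.of (MvPolynomial (Fin n) k)))
      (_ : f = Spec.map (CommRingCat.ofHom φ)) (hsf : f.base (π.base v) = π.base v) (F : (MvPolynomial (Fin n) k)),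
      ((Spec (CommRingCat.of (MvPolynomial (Fin n) k))).presheaf.stalkSpecializes (specializes_of_eq hsf) ≫
        f.stalkMap (π.base v)).hom (γ F) = γ (φ F) := by
    intro f hf hsf F
    subst hf
    rw [hγdef]
    exact TerminalBlowup.stalkAction_germ φ (π.base v) hsf F
  have hbγ : ∀ F : (MvPolynomial (Fin n) k), bH.hom (γ F) = γ (g⁻¹ • F) := fun F => key _ (hρ g) hs F
  have hrel : ∀ l : Fin 2, (π.stalkMap v).hom (γ (K j)) * χ (chartGen (fun l => γ (K l)) j l) =
      (π.stalkMap v).hom (γ (K l)) := fun l =>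
    (congrArg (· * χ (chartGen (fun l => γ (K l)) j l)) (hχ (γ (K j))).symm).trans
      (((map_mul χ _ _).symm.trans
        (congrArg χ (reesChartBase_apply_eq_mul_chartGen (fun l => γ (K l)) j l)).symm).trans
          (hχ (γ (K l))))
  have hTnzd : (π.stalkMap v).hom (γ (K j)) ∈ nonZeroDivisors (V.presheaf.stalk v) := by
    letI := χ.toAlgebra
    haveI : IsLocalization 𝔴.asIdeal.primeCompl (V.presheaf.stalk v) := hloc
    have h := IsLocalization.nonZeroDivisors_le_comap 𝔴.asIdeal.primeCompl (V.presheaf.stalk v)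
      (reesChartBase_mem_nonZeroDivisors (γ (K j))
        (Ideal.mem_span_range_self (f := fun l => γ (K l)) (x := j)))
    have hA : algebraMap (chartRing (fun l => γ (K l)) j) (V.presheaf.stalk v) = χ :=
      RingHom.algebraMap_toAlgebra χ
    have e : algebraMap (chartRing (fun l => γ (K l)) j) (V.presheaf.stalk v)
        (chartBase (fun l => γ (K l)) j (γ (K j))) = (π.stalkMap v).hom (γ (K j)) :=
      (congrArg (fun f : chartRing (fun l => γ (K l)) j →+* V.presheaf.stalk v =>
        f (chartBase (fun l => γ (K l)) j (γ (K j)))) hA).trans (hχ (γ (K j)))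
    exact e ▸ (Submonoid.mem_comap.mp h)
  have haug : Ideal.span (Set.range fun y => aH.hom y - y) =
      (Ideal.span (Set.range fun r => bH.hom r - r)).map (π.stalkMap v).hom ⊔
        Ideal.span (Set.range fun l : {l : Fin 2 // l ≠ j} =>
          aH.hom (χ (chartGen (fun l => γ (K l)) j l.1)) - χ (chartGen (fun l => γ (K l)) j l.1)) := by
    letI := χ.toAlgebra
    haveI : IsLocalization 𝔴.asIdeal.primeCompl (V.presheaf.stalk v) := hloc
    have hA : algebraMap (chartRing (fun l => γ (K l)) j) (V.presheaf.stalk v) = χ :=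
      RingHom.algebraMap_toAlgebra χ
    have hχ' : ∀ r, algebraMap (chartRing (fun l => γ (K l)) j) (V.presheaf.stalk v)
        (chartBase (fun l => γ (K l)) j r) = (π.stalkMap v).hom r := fun r =>
      (congrArg (fun f : chartRing (fun l => γ (K l)) j →+* V.presheaf.stalk v =>
        f (chartBase (fun l => γ (K l)) j r)) hA).trans (hχ r)
    have h := JordanThree.span_sub_eq_map_sup_span_of_chart (chartBase (fun l => γ (K l)) j)
      (fun l : {l : Fin 2 // l ≠ j} => chartGen (fun l => γ (K l)) j l.1)
      (eval₂Hom_chartGen_surjective (fun l => γ (K l)) j) 𝔴.asIdeal.primeCompl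
      (π.stalkMap v).hom hχ' bH.hom aH.hom hab'
    rw [hA] at h
    exact h
  have haugb : Ideal.span (Set.range fun r => bH.hom r - r) =
      (Ideal.span ({X a, X b} : Set (MvPolynomial (Fin n) k))).map γ := by
    apply le_antisymm
    · -- `⊆`: check on `k[x]` (ring maps out of a localisation)
      have hagree : (Ideal.Quotient.mk ((Ideal.span ({X a, X b} :
            Set (MvPolynomial (Fin n) k))).map γ)).comp bH.hom =
          Ideal.Quotient.mk ((Ideal.span ({X a, X b} : Set (MvPolynomial (Fin n) k))).map γ) := by
        letI : Algebra (MvPolynomial (Fin n) k)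
            ((Spec (CommRingCat.of (MvPolynomial (Fin n) k))).presheaf.stalk (π.base v)) :=
          StructureSheaf.stalkAlgebra (↑(CommRingCat.of (MvPolynomial (Fin n) k))) (π.base v)
        haveI : IsLocalization.AtPrime
            ((Spec (CommRingCat.of (MvPolynomial (Fin n) k))).presheaf.stalk (π.base v))
            (π.base v).asIdeal :=
          StructureSheaf.IsLocalization.to_stalk (↑(CommRingCat.of (MvPolynomial (Fin n) k)))
            (π.base v)
        have halg : ∀ F : MvPolynomial (Fin n) k, algebraMap (MvPolynomial (Fin n) k)
            ((Spec (CommRingCat.of (MvPolynomial (Fin n) k))).presheaf.stalk (π.base v)) F =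
            γ F := fun F => by rw [hγdef]; rfl
        apply IsLocalization.ringHom_ext (π.base v).asIdeal.primeCompl
          (S := (Spec (CommRingCat.of (MvPolynomial (Fin n) k))).presheaf.stalk (π.base v))
        refine RingHom.ext fun F => ?_
        simp only [RingHom.comp_apply, halg]
        rw [hbγ, Ideal.Quotient.eq, ← map_sub]
        exact Ideal.mem_map_of_mem γ (JordanThree.smul_sub_mem_centre k n σ a b c hb hc hσ g⁻¹ F)
      refine Ideal.span_le.mpr ?_
      rintro _ ⟨r, rfl⟩
      have h := RingHom.congr_fun hagree r
      rw [RingHom.comp_apply, Ideal.Quotient.eq] at h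
      exact h
    · -- `⊇`: `γ (g⁻¹ • F - F) = b (γ F) - γ F` and `(x_a, x_b) = ⟨g⁻¹ • F - F⟩`
      have e := congrArg (Ideal.map γ)
        (span_smul_sub_eq_centre_prime p hp hp3 k n σ a b c hab hac hb hc hσ g⁻¹ hg')
      rw [← e]
      refine Ideal.map_le_iff_le_comap.mpr (Ideal.span_le.mpr ?_)
      rintro _ ⟨F, rfl⟩
      rw [SetLike.mem_coe, Ideal.mem_comap, map_sub, ← hbγ]
      exact Ideal.subset_span ⟨γ F, rfl⟩
  have hmapι : ((Ideal.span ({X a, X b} : Set (MvPolynomial (Fin n) k))).map γ).map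
      (π.stalkMap v).hom =
      Ideal.span {(π.stalkMap v).hom (γ (X a)), (π.stalkMap v).hom (γ (X b))} := by
    rw [Ideal.map_map, Ideal.map_span, Set.image_insert_eq, Set.image_singleton]
    rfl
  have heq : Ideal.span (Set.range fun y => aH.hom y - y) =
      Ideal.span {(π.stalkMap v).hom (γ (X a)), (π.stalkMap v).hom (γ (X b))} ⊔
        Ideal.span (Set.range fun l : {l : Fin 2 // l ≠ j} =>
          aH.hom (χ (chartGen (fun l => γ (K l)) j l.1)) - χ (chartGen (fun l => γ (K l)) j l.1)) :=
    haug.trans (congrArg₂ (· ⊔ ·)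
      ((congrArg (Ideal.map (π.stalkMap v).hom) haugb).trans hmapι) rfl)
  rw [heq]
  have haXa : aH.hom ((π.stalkMap v).hom (γ (X a))) = (π.stalkMap v).hom (γ (X a)) := by
    rw [hab', hbγ, hgXa]
  have haXb : aH.hom ((π.stalkMap v).hom (γ (X b))) =
      (π.stalkMap v).hom (γ (X b)) + (m : V.presheaf.stalk v) * (π.stalkMap v).hom (γ (X a)) := by
    rw [hab', hbγ, hgXb, map_add, map_mul, map_natCast, map_add, map_mul, map_natCast]
  have hKl : ∀ l : Fin 2, (π.stalkMap v).hom (γ (K l)) =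
      ![(π.stalkMap v).hom (γ (X a)), (π.stalkMap v).hom (γ (X b)) ^ 2] l := by
    intro l
    fin_cases l <;> simp [hK0, hK1, map_pow]
  refine I2.chart_isPrincipal ((π.stalkMap v).hom (γ (X a))) ((π.stalkMap v).hom (γ (X b)))
    ((π.stalkMap v).hom (γ (K j))) (m : V.presheaf.stalk v)
    (fun l => χ (chartGen (fun l => γ (K l)) j l))
    aH.hom haXa haXb hTnzd j (hKl j) ?_ ?_ hmem
  · rw [hrel]; simpa using hKl 0
  · rw [hrel]; simpa using hKl 1

end Summit.ResolutionOfSingularities.ResolutionOfSingularities.Theorems.WildQuotientResolution.ToricExit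

end
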